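import Summits.NavierStokesRegularity.NavierStokesRegularity.Theorems.TypeICertificateLadderTargetFlowwiseDepletionCoeffSlab
import Summits.NavierStokesRegularity.NavierStokesRegularity.Theorems.TypeICertificateLadderTargetFlowwiseDepletionRung
import HarnessLib

/-!
# Crux `Target` = `TypeICertificateLadder.NoTypeIBlowup` (stmt-NavierStokesRegularity-1217), line
# `depletion-ladder`: rungs from EVENTUAL flow-wise depletion; the alignment criterion FREQUENTLY AS `t ↑ T`

`--supports stmt-NavierStokesRegularity-1217` (eventual-in-time version of the landed
`…TargetFlowwiseDepletionRung.lean`; uses the time-dependent-coefficient slab inequality of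
`…TargetFlowwiseDepletionCoeffSlab.lean`).

The landed flow-wise S2 and alignment criterion assume the depletion bound on ALL of `[0,T)`; here
only on `[t₁, T)`: before the onset the Cauchy–Schwarz member `κ = 1` (`stretchingDepletion_one`) is
used, after it `κ`; the slab Grönwall with coefficient `k = 𝟙_{[0,t₀)} + κ 𝟙_{[t₀,T)}` has
`∫₀ᵗ k²‖u‖²_∞ ≤ B₀²T + κ²C²ν log(T/(T−t))`, so the growth exponent is still `κ²C²/2`.

* `lintegral_curl_sq_le_rpow_of_rate_eventual`, `energy_add_enstrophy_le_rpow_of_rate_eventual`,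
  `rung_of_eventualDepletion` — **eventual flow-wise S2**: a classical Leray–Hopf
  rapidly-decaying-datum solution on `[0,T)` with eventual rate `C` and the depletion bound with
  `κ ≥ 0`, `κC < 1`, along the solution on SOME `[t₁, T)` extends smoothly past `T`.
* `hasSmoothExtensionPast_of_eventually_alignedPalinstrophyFraction` — if
  `η² ∫|∇ω(t)|²_F ≤ ∫⟪u(t), curl ω(t)⟫²/‖u(t)‖²` for all `t` in some `[t₁,T)` and `(1−η²)C² < 1`,
  the solution extends.
* `frequently_alignedPalinstrophyFraction_lt` — **the alignment criterion, sharp-in-time form**: at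
  a singular time `T` approached at dimensionless rate `C`, for every `η ∈ [0,1]` with
  `(1−η²)C² < 1` the aligned palinstrophy fraction drops below `η²` FREQUENTLY as `t ↑ T`
  (`∃ᶠ t → T⁻`): Type-I blow-up needs recurrent velocity–palinstrophy decorrelation
  `A(t) < 1 − C⁻² + ε` arbitrarily close to the singular time.

WHAT THIS IS NOT: conditional statements (doors); no depletion constant and no rung is proved.
Elementary given the landed chain. References: Leray 1934 §§19–20; Lemarié-Rieusset (2016),
Thm. 11.2; T. Tao, arXiv:1108.1165. [folklore]
-/

noncomputable section

open Set Filter Topology MeasureTheory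
open scoped RealInnerProductSpace ENNReal NNReal Laplacian ContDiff
open Literature.Analysis.FluidPDE

namespace Summit.NavierStokesRegularity.NavierStokesRegularity.Theorems.DepletionLadder

-- the problem directory repeats the summit name (`NavierStokesRegularity/NavierStokesRegularity`)
set_option linter.dupNamespace false

open Summit.NavierStokesRegularity.NavierStokesRegularity.Theorems.RungReynoldsOne
open Summit.NavierStokesRegularity.NavierStokesRegularity.Theorems.SimilarityEnstrophy

/-- **Depleted enstrophy Grönwall against the rate, eventual form.** Classical Leray–Hopf
rapidly-decaying-datum solution on `[0,T)`, eventual rate `C`, depletion bound `κ ≥ 0` along the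
solution on `[t₁,T)`: `∫‖curl u(t)‖² ≤ K (T−t)^{−κ²C²/2}` on `(0,T)` (coefficient `1` before the onset
`t₀ > t₁`, `κ` after). [folklore] -/
theorem lintegral_curl_sq_le_rpow_of_rate_eventual {ν κ T C t₁ : ℝ} (hν : 0 < ν) (hT : 0 < T)
    (hκ : 0 ≤ κ) (ht₁ : t₁ ∈ Ico 0 T)
    {u : ℝ → EuclideanSpace ℝ (Fin 3) → EuclideanSpace ℝ (Fin 3)}
    {p : ℝ → EuclideanSpace ℝ (Fin 3) → ℝ}
    (hsol : IsClassicalNSSolutionOn (Ico 0 T) ν 0 u p) (hLH : IsLerayHopfOn T ν 0 (u 0) u)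
    (hdec : HasRapidSpatialDecay (u 0))
    (hflow : ∀ t ∈ Ico t₁ T, ∀ M : ℝ, (∀ x, ‖u t x‖ ≤ M) →
      |∫ x, ⟪curl (u t) x, fderiv ℝ (u t) x (curl (u t) x)⟫| ≤
        κ * M * Real.sqrt (∫ x, ‖curl (u t) x‖ ^ 2) *
          Real.sqrt (∫ x, frobeniusNormSq (fderiv ℝ (curl (u t)) x)))
    (hrate : ∀ᶠ t in 𝓝[<] T, ∀ x, Real.sqrt (T - t) * ‖u t x‖ ≤ C * Real.sqrt ν) :
    ∃ K : ℝ, 0 ≤ K ∧ ∀ t ∈ Ioo 0 T,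
      ∫⁻ x, ‖curl (u t) x‖ₑ ^ 2 ≤ ENNReal.ofReal (K * (T - t) ^ (-(κ ^ 2 * C ^ 2 / 2))) := by
  -- the onset `t₀ ∈ (t₁, T)` of the rate AND of the depletion bound
  obtain ⟨a, haT, hsub⟩ := mem_nhdsLT_iff_exists_Ioo_subset.1 hrate
  set t₀ : ℝ := (max (max a (T / 2)) t₁ + T) / 2 with ht₀def
  have hmax : max (max a (T / 2)) t₁ < T := max_lt (max_lt haT (by linarith)) ht₁.2
  have hat₀ : a < t₀ := by
    have := (le_max_left a (T / 2)).trans (le_max_left (max a (T / 2)) t₁); rw [ht₀def]; linarith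
  have ht₁t₀ : t₁ < t₀ := by
    have := le_max_right (max a (T / 2)) t₁; rw [ht₀def]; linarith
  have ht₀ : t₀ ∈ Ioo 0 T := by
    have := (le_max_right a (T / 2)).trans (le_max_left (max a (T / 2)) t₁)
    rw [ht₀def]; constructor <;> linarith
  set k : ℝ → ℝ := fun s => if s < t₀ then 1 else κ with hkdef
  have hk0 : ∀ s, 0 ≤ k s := fun s => by
    rw [hkdef]; simp only; split_ifs <;> [exact zero_le_one; exact hκ]
  have hrate' : ∀ s ∈ Ico t₀ T, ∀ x, Real.sqrt (T - s) * ‖u s x‖ ≤ C * Real.sqrt ν :=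
    fun s hs => hsub ⟨hat₀.trans_le hs.1, hs.2⟩
  -- a sup bound on `[0, t₀]` from the Tao cover at `T' = t₀`
  obtain ⟨q₀, hsol₀, hu₀, -, -⟩ := stub_taoCover hν hT hsol hLH hdec ht₀
  obtain ⟨B₀, hB₀0, hB₀⟩ := exists_forall_norm_le_of_hasBoundedSobolevNormsOn hsol₀ hu₀
  obtain ⟨C₁, hC₁⟩ := hu₀ 1
  -- the weighted sup-norm bound `k(s)²‖u(s)‖²_∞ ≤ B₀² + κ²C²ν/(T−s)` on `[0, T)`
  have hNsq : ∀ s ∈ Ico 0 T, k s ^ 2 * (eLpNorm (u s) ⊤ volume).toReal ^ (2 : ℝ) ≤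
      B₀ ^ 2 + κ ^ 2 * C ^ 2 * ν / (T - s) := by
    intro s hs
    have hTs : 0 < T - s := sub_pos.2 hs.2
    rw [Real.rpow_two]
    by_cases hst : s < t₀
    · have hks : k s = 1 := by rw [hkdef]; simp only; rw [if_pos hst]
      have h1 : (eLpNorm (u s) ⊤ volume).toReal ≤ B₀ :=
        toReal_eLpNorm_top_le_of_bound hB₀0 (hB₀ s ⟨hs.1, hst.le⟩)
      have h2 : 0 ≤ κ ^ 2 * C ^ 2 * ν / (T - s) := by positivity
      rw [hks, one_pow, one_mul]
      nlinarith [ENNReal.toReal_nonneg (a := eLpNorm (u s) ⊤ volume)]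
    · have hks : k s = κ := by rw [hkdef]; simp only; rw [if_neg hst]
      have hb : 0 ≤ Real.sqrt (C ^ 2 * ν / (T - s)) := Real.sqrt_nonneg _
      have h1 : ∀ x, ‖u s x‖ ≤ Real.sqrt (C ^ 2 * ν / (T - s)) := fun x =>
        Real.le_sqrt_of_sq_le
          (sq_norm_le_of_rate_mul hν.le hs.2 (hrate' s ⟨not_lt.1 hst, hs.2⟩ x))
      have h2 : (eLpNorm (u s) ⊤ volume).toReal ≤ Real.sqrt (C ^ 2 * ν / (T - s)) :=
        toReal_eLpNorm_top_le_of_bound hb h1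
      have h3 := pow_le_pow_left₀ ENNReal.toReal_nonneg h2 2
      rw [Real.sq_sqrt (by positivity)] at h3
      rw [hks]
      have h4 := mul_le_mul_of_nonneg_left h3 (sq_nonneg κ)
      have h5 : κ ^ 2 * (C ^ 2 * ν / (T - s)) = κ ^ 2 * C ^ 2 * ν / (T - s) := by ring
      nlinarith [sq_nonneg B₀]
  -- the integrated bound `Λ_k(t) ≤ B₀²T + κ²C²ν log(T/(T−t))`
  have hΛ : ∀ t ∈ Ioo 0 T,
      ∫⁻ s in Ioo 0 t, ENNReal.ofReal (k s ^ 2 * (eLpNorm (u s) ⊤ volume).toReal ^ (2 : ℝ)) ≤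
        ENNReal.ofReal (B₀ ^ 2 * T + κ ^ 2 * C ^ 2 * ν * Real.log (T / (T - t))) := by
    intro t ht
    have hTt : 0 < T - t := sub_pos.2 ht.2
    have hlog : 0 ≤ Real.log (T / (T - t)) :=
      Real.log_nonneg ((one_le_div hTt).2 (by linarith [ht.1]))
    have hC2 : 0 ≤ κ ^ 2 * C ^ 2 * ν := by positivity
    calc ∫⁻ s in Ioo 0 t, ENNReal.ofReal (k s ^ 2 * (eLpNorm (u s) ⊤ volume).toReal ^ (2 : ℝ))
        ≤ ∫⁻ s in Ioo 0 t, (ENNReal.ofReal (B₀ ^ 2) +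
            ENNReal.ofReal (κ ^ 2 * C ^ 2 * ν / (T - s))) := by
          refine setLIntegral_mono' measurableSet_Ioo fun s hs => ?_
          rw [← ENNReal.ofReal_add (sq_nonneg _) (div_nonneg hC2 (by linarith [hs.2, ht.2]))]
          exact ENNReal.ofReal_le_ofReal (hNsq s ⟨hs.1.le, hs.2.trans ht.2⟩)
      _ = ENNReal.ofReal (B₀ ^ 2) * volume (Ioo 0 t) +
            ∫⁻ s in Ioo 0 t, ENNReal.ofReal (κ ^ 2 * C ^ 2 * ν / (T - s)) := by
          rw [lintegral_add_left measurable_const, setLIntegral_const]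
      _ = ENNReal.ofReal (B₀ ^ 2 * t) +
            ENNReal.ofReal (κ ^ 2 * C ^ 2 * ν * Real.log (T / (T - t))) := by
          rw [lintegral_Ioo_div_sub_eq hC2 ht.1.le ht.2, Real.volume_Ioo, sub_zero,
            ← ENNReal.ofReal_mul (sq_nonneg _)]
      _ = ENNReal.ofReal (B₀ ^ 2 * t + κ ^ 2 * C ^ 2 * ν * Real.log (T / (T - t))) :=
          (ENNReal.ofReal_add (mul_nonneg (sq_nonneg _) ht.1.le) (mul_nonneg hC2 hlog)).symm
      _ ≤ ENNReal.ofReal (B₀ ^ 2 * T + κ ^ 2 * C ^ 2 * ν * Real.log (T / (T - t))) := by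
          refine ENNReal.ofReal_le_ofReal ?_
          nlinarith [sq_nonneg B₀, ht.2]
  -- finiteness of the enstrophy at time `0`
  have h00 : (0 : ℝ) ∈ Icc 0 t₀ := ⟨le_rfl, ht₀.1.le⟩
  have hZ0 : ∫⁻ x, ‖curl (u 0) x‖ₑ ^ 2 ≤ 6 * C₁ := by
    calc ∫⁻ x, ‖curl (u 0) x‖ₑ ^ 2 ≤ ∫⁻ x, 6 * ‖iteratedFDeriv ℝ 1 (u 0) x‖ₑ ^ 2 :=
          lintegral_mono fun x => enorm_curl_sq_le_six_mul (u 0) x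
      _ = 6 * ∫⁻ x, ‖iteratedFDeriv ℝ 1 (u 0) x‖ₑ ^ 2 := lintegral_const_mul' _ _ (by norm_num)
      _ ≤ 6 * C₁ := by gcongr; exact hC₁ 0 h00
  have hZ0top : ∫⁻ x, ‖curl (u 0) x‖ₑ ^ 2 ≠ ⊤ :=
    (hZ0.trans_lt (ENNReal.mul_lt_top (by norm_num) ENNReal.coe_lt_top)).ne
  set Z0 : ℝ := (∫⁻ x, ‖curl (u 0) x‖ₑ ^ 2).toReal with hZ0def
  have hZ0nn : 0 ≤ Z0 := ENNReal.toReal_nonneg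
  -- the constant
  set kν : ℝ := 1 / (2 * ν) with hkν
  have hkν0 : 0 ≤ kν := by positivity
  set γ : ℝ := κ ^ 2 * C ^ 2 / 2 with hγ
  have hγk : kν * (κ ^ 2 * C ^ 2 * ν) = γ := by
    rw [hkν, hγ]
    field_simp
  set K : ℝ := Real.exp (kν * (B₀ ^ 2 * T)) * T ^ γ * Z0 with hK
  refine ⟨K, by positivity, fun t ht => ?_⟩
  obtain ⟨q, hsolt, hut, hutt, -⟩ := stub_taoCover hν hT hsol hLH hdec ht
  have hTt : 0 < T - t := sub_pos.2 ht.2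
  have hΛt := hΛ t ht
  have hΛtop : ∫⁻ s in Ioo 0 t,
      ENNReal.ofReal (k s ^ 2 * (eLpNorm (u s) ⊤ volume).toReal ^ (2 : ℝ)) ≠ ⊤ :=
    (hΛt.trans_lt ENNReal.ofReal_lt_top).ne
  have hflow_t : ∀ s ∈ Icc 0 t, ∀ M : ℝ, (∀ x, ‖u s x‖ ≤ M) →
      |∫ x, ⟪curl (u s) x, fderiv ℝ (u s) x (curl (u s) x)⟫| ≤
        k s * M * Real.sqrt (∫ x, ‖curl (u s) x‖ ^ 2) *
          Real.sqrt (∫ x, frobeniusNormSq (fderiv ℝ (curl (u s)) x)) := by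
    intro s hs M hM
    by_cases hst : s < t₀
    · have hks : k s = 1 := by rw [hkdef]; simp only; rw [if_pos hst]
      obtain ⟨iZ, iA, iJ⟩ := slice_integrability hsolt hut hs
      have hsI : s ∈ Icc 0 t := hs
      rw [hks]
      exact stretchingDepletion_one (u s) M ((hsolt.contDiff_velocity hsI).of_le (by norm_cast))
        (hsolt.divFree s hsI) hM iZ iA iJ
    · have hks : k s = κ := by rw [hkdef]; simp only; rw [if_neg hst]
      rw [hks]
      exact hflow s ⟨ht₁t₀.le.trans (not_lt.1 hst), hs.2.trans_lt ht.2⟩ M hM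
  have hmain := lintegral_curl_sq_le_exp_of_flowwise_coeff hν ht.1 hsolt k hflow_t hut hutt
    ⟨ht.1, le_rfl⟩ hΛtop
  refine hmain.trans ?_
  have hlog : 0 ≤ Real.log (T / (T - t)) :=
    Real.log_nonneg ((one_le_div hTt).2 (by linarith [ht.1]))
  have hrhs0 : 0 ≤ B₀ ^ 2 * T + κ ^ 2 * C ^ 2 * ν * Real.log (T / (T - t)) := by positivity
  have hexp : Real.exp (1 / (2 * ν) *
      (∫⁻ s in Ioo 0 t,
        ENNReal.ofReal (k s ^ 2 * (eLpNorm (u s) ⊤ volume).toReal ^ (2 : ℝ))).toReal) ≤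
      Real.exp (kν * (B₀ ^ 2 * T)) * (T / (T - t)) ^ γ := by
    have h1 : (∫⁻ s in Ioo 0 t,
        ENNReal.ofReal (k s ^ 2 * (eLpNorm (u s) ⊤ volume).toReal ^ (2 : ℝ))).toReal ≤
        B₀ ^ 2 * T + κ ^ 2 * C ^ 2 * ν * Real.log (T / (T - t)) :=
      ENNReal.toReal_le_of_le_ofReal hrhs0 hΛt
    have h2 := Real.exp_le_exp.2 (mul_le_mul_of_nonneg_left h1 hkν0)
    refine h2.trans_eq ?_
    rw [exp_mul_add_mul_log (div_pos hT hTt), hγk]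
  have hpow : (T / (T - t)) ^ γ = T ^ γ * (T - t) ^ (-γ) := by
    rw [Real.div_rpow hT.le hTt.le, Real.rpow_neg hTt.le, div_eq_mul_inv]
  calc ENNReal.ofReal (Real.exp (1 / (2 * ν) *
        (∫⁻ s in Ioo 0 t,
          ENNReal.ofReal (k s ^ 2 * (eLpNorm (u s) ⊤ volume).toReal ^ (2 : ℝ))).toReal)) *
        ∫⁻ x, ‖curl (u 0) x‖ₑ ^ 2
      ≤ ENNReal.ofReal (Real.exp (kν * (B₀ ^ 2 * T)) * (T / (T - t)) ^ γ) * ENNReal.ofReal Z0 := by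
        rw [ENNReal.ofReal_toReal hZ0top]
        gcongr
    _ = ENNReal.ofReal (K * (T - t) ^ (-γ)) := by
        rw [← ENNReal.ofReal_mul (by positivity), hpow, hK]
        ring_nf

/-- **The `H¹`-type power rate under rate `C` and depletion `κ`** (eventual form): under the depletion bound with constant `κ` ALONG the solution on `[t₁,T)`, along every classical
Leray–Hopf rapidly-decaying-datum solution on `[0,T)` with eventual rate `√(T−t)‖u(t,x)‖ ≤ C√ν`,
`‖u(t)‖₂² + ‖∇u(t)‖₂² ≤ K′(T−t)^{−κ²C²/2}` for all `t ∈ [T/2, T)`: energy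
`≤ 2E(u₀)` (`IsLerayHopfOn.lintegral_enorm_sq_le`), `∫|∇u|² ≤ ∫|curl u|²`
(`lintegral_frobeniusNormSq_fderiv_le_lintegral_sq_norm_curl`) and
`lintegral_curl_sq_le_rpow_of_rate_eventual`. [folklore] -/
theorem energy_add_enstrophy_le_rpow_of_rate_eventual {ν κ T C t₁ : ℝ} (hν : 0 < ν) (hT : 0 < T)
    (hκ : 0 ≤ κ) (ht₁ : t₁ ∈ Ico 0 T)
    {u : ℝ → EuclideanSpace ℝ (Fin 3) → EuclideanSpace ℝ (Fin 3)}
    {p : ℝ → EuclideanSpace ℝ (Fin 3) → ℝ}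
    (hsol : IsClassicalNSSolutionOn (Ico 0 T) ν 0 u p) (hLH : IsLerayHopfOn T ν 0 (u 0) u)
    (hdec : HasRapidSpatialDecay (u 0))
    (hflow : ∀ t ∈ Ico t₁ T, ∀ M : ℝ, (∀ x, ‖u t x‖ ≤ M) →
      |∫ x, ⟪curl (u t) x, fderiv ℝ (u t) x (curl (u t) x)⟫| ≤
        κ * M * Real.sqrt (∫ x, ‖curl (u t) x‖ ^ 2) *
          Real.sqrt (∫ x, frobeniusNormSq (fderiv ℝ (curl (u t)) x)))
    (hrate : ∀ᶠ t in 𝓝[<] T, ∀ x, Real.sqrt (T - t) * ‖u t x‖ ≤ C * Real.sqrt ν) :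
    ∃ K : ℝ, ∃ t₀ ∈ Ico 0 T, ∀ t ∈ Ico t₀ T,
      (∫⁻ x, ‖u t x‖ₑ ^ 2) + ∫⁻ x, ENNReal.ofReal (frobeniusNormSq (fderiv ℝ (u t) x)) ≤
        ENNReal.ofReal (K * (T - t) ^ (-(κ ^ 2 * C ^ 2 / 2))) := by
  obtain ⟨K, hK0, hK⟩ := lintegral_curl_sq_le_rpow_of_rate_eventual hν hT hκ ht₁ hsol hLH hdec hflow hrate
  set γ : ℝ := κ ^ 2 * C ^ 2 / 2 with hγ
  have hγ0 : 0 ≤ γ := by positivity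
  set E₀ : ℝ := 2 * VectorCalculus.kineticEnergy (u 0) with hE₀
  -- the energy bound, made nonnegative
  have hE : ∀ t ∈ Icc 0 T, ∫⁻ x, ‖u t x‖ₑ ^ 2 ≤ ENNReal.ofReal (max E₀ 0) := fun t ht =>
    (hLH.lintegral_enorm_sq_le hν.le ht).trans (ENNReal.ofReal_le_ofReal (le_max_left _ _))
  refine ⟨max E₀ 0 * T ^ γ + K, T / 2, ⟨by positivity, by linarith⟩, fun t ht => ?_⟩
  have ht' : t ∈ Ioo 0 T := ⟨lt_of_lt_of_le (by positivity) ht.1, ht.2⟩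
  have htc : t ∈ Icc 0 T := ⟨ht'.1.le, ht'.2.le⟩
  have htI : t ∈ Ico 0 T := ⟨ht'.1.le, ht'.2⟩
  have hTt : 0 < T - t := sub_pos.2 ht.2
  -- `∫|∇u(t)|² ≤ ∫|curl u(t)|²`
  have hL2 : ∫⁻ x, ‖u t x‖ₑ ^ 2 < ⊤ := (hE t htc).trans_lt ENNReal.ofReal_lt_top
  have hG : ∫⁻ x, ENNReal.ofReal (frobeniusNormSq (fderiv ℝ (u t) x)) ≤ ∫⁻ x, ‖curl (u t) x‖ₑ ^ 2 :=
    lintegral_frobeniusNormSq_fderiv_le_lintegral_sq_norm_curl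
      ((hsol.contDiff_velocity htI).of_le (by norm_cast)) (hsol.divFree t htI) hL2
  -- `max E₀ 0 ≤ max E₀ 0 · T^γ (T−t)^{−γ}`
  have hone : 1 ≤ T ^ γ * (T - t) ^ (-γ) := by
    rw [Real.rpow_neg hTt.le, ← div_eq_mul_inv, ← Real.div_rpow hT.le hTt.le]
    exact Real.one_le_rpow ((one_le_div hTt).2 (by linarith [ht'.1])) hγ0
  have hE' : max E₀ 0 ≤ max E₀ 0 * T ^ γ * (T - t) ^ (-γ) := by
    have := mul_le_mul_of_nonneg_left hone (le_max_right E₀ 0)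
    rw [mul_one] at this
    simpa [mul_assoc] using this
  calc (∫⁻ x, ‖u t x‖ₑ ^ 2) + ∫⁻ x, ENNReal.ofReal (frobeniusNormSq (fderiv ℝ (u t) x))
      ≤ ENNReal.ofReal (max E₀ 0) + ENNReal.ofReal (K * (T - t) ^ (-γ)) :=
        add_le_add (hE t htc) (hG.trans (hK t ht'))
    _ = ENNReal.ofReal (max E₀ 0 + K * (T - t) ^ (-γ)) :=
        (ENNReal.ofReal_add (le_max_right _ _) (by positivity)).symm
    _ ≤ ENNReal.ofReal ((max E₀ 0 * T ^ γ + K) * (T - t) ^ (-γ)) := by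
        refine ENNReal.ofReal_le_ofReal ?_
        rw [add_mul]
        exact add_le_add hE' le_rfl

/-- **Eventual flow-wise S2.** Let `u` be a classical solution of the unforced Navier–Stokes system
on `ℝ³ × [0,T)` (`ν, T > 0`), Leray–Hopf from its rapidly decaying datum, with eventual dimensionless
rate `√(T−t)‖u(t,x)‖ ≤ C√ν`. If for some `κ ≥ 0` with `κC < 1` and some `t₁ ∈ [0,T)` the depletion
bound `|∫⟪ω(t), Du(t) ω(t)⟫| ≤ κ M ‖ω(t)‖₂ ‖∇ω(t)‖₂` holds for every `t ∈ [t₁,T)` and every bound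
`M` of `|u(t)|`, then `u` extends smoothly past `T`. [folklore] -/
theorem rung_of_eventualDepletion {ν κ T C t₁ : ℝ} (hν : 0 < ν) (hT : 0 < T) (hκ : 0 ≤ κ)
    (hC : 0 < C) (hκC : κ * C < 1) (ht₁ : t₁ ∈ Ico 0 T)
    {u : ℝ → EuclideanSpace ℝ (Fin 3) → EuclideanSpace ℝ (Fin 3)}
    {p : ℝ → EuclideanSpace ℝ (Fin 3) → ℝ}
    (hsol : IsClassicalNSSolutionOn (Ico 0 T) ν 0 u p) (hLH : IsLerayHopfOn T ν 0 (u 0) u)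
    (hdec : HasRapidSpatialDecay (u 0))
    (hflow : ∀ t ∈ Ico t₁ T, ∀ M : ℝ, (∀ x, ‖u t x‖ ≤ M) →
      |∫ x, ⟪curl (u t) x, fderiv ℝ (u t) x (curl (u t) x)⟫| ≤
        κ * M * Real.sqrt (∫ x, ‖curl (u t) x‖ ^ 2) *
          Real.sqrt (∫ x, frobeniusNormSq (fderiv ℝ (curl (u t)) x)))
    (hrate : ∀ᶠ t in 𝓝[<] T, ∀ x, Real.sqrt (T - t) * ‖u t x‖ ≤ C * Real.sqrt ν) :
    HasSmoothExtensionPast ν 0 u T := by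
  set κ' : ℝ := (1 + κ * C) / (2 * C) with hκ'
  have hκ'pos : 0 < κ' := by rw [hκ']; positivity
  have hκ'C : κ' * C < 1 := by
    rw [hκ', div_mul_eq_mul_div, div_lt_one (by positivity)]
    nlinarith
  have hκle : κ ≤ κ' := by
    rw [hκ', le_div_iff₀ (by positivity)]
    nlinarith
  have hflow' : ∀ t ∈ Ico t₁ T, ∀ M : ℝ, (∀ x, ‖u t x‖ ≤ M) →
      |∫ x, ⟪curl (u t) x, fderiv ℝ (u t) x (curl (u t) x)⟫| ≤
        κ' * M * Real.sqrt (∫ x, ‖curl (u t) x‖ ^ 2) *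
          Real.sqrt (∫ x, frobeniusNormSq (fderiv ℝ (curl (u t)) x)) := by
    intro t ht M hM
    have hM0 : 0 ≤ M := (norm_nonneg (u t 0)).trans (hM 0)
    refine (hflow t ht M hM).trans ?_
    have hA : 0 ≤ Real.sqrt (∫ x, ‖curl (u t) x‖ ^ 2) := Real.sqrt_nonneg _
    have hB : 0 ≤ Real.sqrt (∫ x, frobeniusNormSq (fderiv ℝ (curl (u t)) x)) := Real.sqrt_nonneg _
    have h1 : κ * M ≤ κ' * M := mul_le_mul_of_nonneg_right hκle hM0
    exact mul_le_mul_of_nonneg_right (mul_le_mul_of_nonneg_right h1 hA) hB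
  have hγ : κ' ^ 2 * C ^ 2 / 2 < 1 / 2 := by
    have h0 : 0 < κ' * C := mul_pos hκ'pos hC
    have h1 : (κ' * C) ^ 2 < 1 := by nlinarith
    rw [mul_pow] at h1
    linarith
  obtain ⟨K, t₀, ht₀, hK⟩ :=
    energy_add_enstrophy_le_rpow_of_rate_eventual hν hT hκ'pos.le ht₁ hsol hLH hdec hflow' hrate
  exact hasSmoothExtensionPast_of_powerRate hν hT hγ hsol hLH hdec ⟨t₀, ht₀, hK⟩

/-- **The alignment criterion, eventual hypothesis.** Same setting; if for some `η ∈ [0,1]` with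
`(1 − η²)C² < 1` and some `t₁ ∈ [0,T)` the aligned palinstrophy fraction stays above `η²` on
`[t₁, T)`, `η² ∫|∇ω(t)|²_F ≤ ∫⟪u(t), curl ω(t)⟫²/‖u(t)‖²`, then `u` extends smoothly past `T`
(direction-defect law at each slice, `κ = √(1−η²)`, `rung_of_eventualDepletion`). [folklore] -/
theorem hasSmoothExtensionPast_of_eventually_alignedPalinstrophyFraction {ν T C η t₁ : ℝ}
    (hν : 0 < ν) (hT : 0 < T) (hC : 0 < C) (hη0 : 0 ≤ η) (hη1 : η ≤ 1)
    (hηC : (1 - η ^ 2) * C ^ 2 < 1) (ht₁ : t₁ ∈ Ico 0 T)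
    {u : ℝ → EuclideanSpace ℝ (Fin 3) → EuclideanSpace ℝ (Fin 3)}
    {p : ℝ → EuclideanSpace ℝ (Fin 3) → ℝ}
    (hsol : IsClassicalNSSolutionOn (Ico 0 T) ν 0 u p) (hLH : IsLerayHopfOn T ν 0 (u 0) u)
    (hdec : HasRapidSpatialDecay (u 0))
    (hA : ∀ t ∈ Ico t₁ T, η ^ 2 * ∫ x, frobeniusNormSq (fderiv ℝ (curl (u t)) x) ≤
      ∫ x, ⟪u t x, curl (curl (u t)) x⟫ ^ 2 / ‖u t x‖ ^ 2)
    (hrate : ∀ᶠ t in 𝓝[<] T, ∀ x, Real.sqrt (T - t) * ‖u t x‖ ≤ C * Real.sqrt ν) :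
    HasSmoothExtensionPast ν 0 u T := by
  set κ : ℝ := Real.sqrt (1 - η ^ 2) with hκdef
  have h1η : 0 ≤ 1 - η ^ 2 := by nlinarith
  have hκ0 : 0 ≤ κ := Real.sqrt_nonneg _
  have hκ2 : κ ^ 2 = 1 - η ^ 2 := Real.sq_sqrt h1η
  have hκC : κ * C < 1 := by
    have h : (κ * C) ^ 2 < 1 := by rw [mul_pow, hκ2]; exact hηC
    have h0 : 0 ≤ κ * C := mul_nonneg hκ0 hC.le
    nlinarith
  refine rung_of_eventualDepletion hν hT hκ0 hC hκC ht₁ hsol hLH hdec (fun t ht M hM => ?_) hrate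
  have htT : t ∈ Ico 0 T := ⟨ht₁.1.trans ht.1, ht.2⟩
  have ht' : (t + T) / 2 ∈ Ioo 0 T := ⟨by linarith [htT.1], by linarith [htT.2]⟩
  obtain ⟨q, hsolt, hut, -, -⟩ := stub_taoCover hν hT hsol hLH hdec ht'
  have htI : t ∈ Icc 0 ((t + T) / 2) := ⟨htT.1, by linarith [htT.2]⟩
  obtain ⟨iZ, iA, iJ⟩ := slice_integrability hsolt hut htI
  have hv3 : ContDiff ℝ 3 (u t) := (hsol.contDiff_velocity htT).of_le (by norm_cast)
  have hv2 : ContDiff ℝ 2 (u t) := (hsol.contDiff_velocity htT).of_le (by norm_cast)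
  have hdiv : VectorCalculus.IsDivFree (u t) := hsol.divFree t htT
  have hdef := sq_integral_stretching_le_direction_defect hv2 hdiv hM iZ iA iJ
  rw [integral_norm_curl_curl_sq_eq hv3 iZ iA] at hdef
  set Z : ℝ := ∫ x, ‖curl (u t) x‖ ^ 2 with hZ
  set W : ℝ := ∫ x, frobeniusNormSq (fderiv ℝ (curl (u t)) x) with hW
  set J : ℝ := ∫ x, ⟪curl (u t) x, fderiv ℝ (u t) x (curl (u t) x)⟫ with hJ
  have hZ0 : 0 ≤ Z := integral_nonneg fun x => sq_nonneg _
  have hW0 : 0 ≤ W := integral_nonneg fun x => frobeniusNormSq_nonneg _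
  have hM0 : 0 ≤ M := (norm_nonneg (u t 0)).trans (hM 0)
  have hJ2 : J ^ 2 ≤ (κ * M * Real.sqrt Z * Real.sqrt W) ^ 2 := by
    have hAt := hA t ht
    have hMZ : 0 ≤ M ^ 2 * Z := mul_nonneg (sq_nonneg _) hZ0
    calc J ^ 2 ≤ M ^ 2 * Z * (W - ∫ x, ⟪u t x, curl (curl (u t)) x⟫ ^ 2 / ‖u t x‖ ^ 2) := hdef
      _ ≤ M ^ 2 * Z * (W * (1 - η ^ 2)) := by
          refine mul_le_mul_of_nonneg_left ?_ hMZ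
          linarith
      _ = (κ * M * Real.sqrt Z * Real.sqrt W) ^ 2 := by
          rw [mul_pow, mul_pow, mul_pow, hκ2, Real.sq_sqrt hZ0, Real.sq_sqrt hW0]; ring
  have hR0 : 0 ≤ κ * M * Real.sqrt Z * Real.sqrt W := by positivity
  exact abs_le_of_sq_le_sq' hJ2 hR0 |> fun h => abs_le.2 h

/-- **The alignment criterion, frequently as `t ↑ T`.** If the classical Leray–Hopf
rapidly-decaying-datum solution `u` on `[0,T)` with eventual dimensionless rate `C > 0` does NOT
extend smoothly past `T`, then for every `η ∈ [0,1]` with `(1 − η²)·C² < 1` the aligned palinstrophy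
fraction drops below `η²` at times arbitrarily close to `T`:
`∃ᶠ t → T⁻, ∫⟪u(t), curl ω(t)⟫²/‖u(t)‖² < η² ∫|∇ω(t)|²_F`. In words: a Type-I blow-up at rate `C`
needs RECURRENT velocity–palinstrophy decorrelation `A(t) < 1 − C⁻² + ε` up to the singular time.
[folklore] -/
theorem frequently_alignedPalinstrophyFraction_lt {ν T C η : ℝ}
    (hν : 0 < ν) (hT : 0 < T) (hC : 0 < C) (hη0 : 0 ≤ η) (hη1 : η ≤ 1)
    (hηC : (1 - η ^ 2) * C ^ 2 < 1)
    {u : ℝ → EuclideanSpace ℝ (Fin 3) → EuclideanSpace ℝ (Fin 3)}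
    {p : ℝ → EuclideanSpace ℝ (Fin 3) → ℝ}
    (hsol : IsClassicalNSSolutionOn (Ico 0 T) ν 0 u p) (hLH : IsLerayHopfOn T ν 0 (u 0) u)
    (hdec : HasRapidSpatialDecay (u 0))
    (hrate : ∀ᶠ t in 𝓝[<] T, ∀ x, Real.sqrt (T - t) * ‖u t x‖ ≤ C * Real.sqrt ν)
    (hsing : ¬ HasSmoothExtensionPast ν 0 u T) :
    ∃ᶠ t in 𝓝[<] T, ∫ x, ⟪u t x, curl (curl (u t)) x⟫ ^ 2 / ‖u t x‖ ^ 2 <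
      η ^ 2 * ∫ x, frobeniusNormSq (fderiv ℝ (curl (u t)) x) := by
  by_contra h
  rw [not_frequently] at h
  obtain ⟨a, haT, hsub⟩ := mem_nhdsLT_iff_exists_Ioo_subset.1 h
  set t₁ : ℝ := (max a 0 + T) / 2 with ht₁def
  have hm : max a 0 < T := max_lt haT hT
  have ht₁ : t₁ ∈ Ico 0 T := by
    have := le_max_right a 0; rw [ht₁def]; constructor <;> linarith
  have hat₁ : a < t₁ := by
    have := le_max_left a 0; rw [ht₁def]; linarith
  have hA : ∀ t ∈ Ico t₁ T, η ^ 2 * ∫ x, frobeniusNormSq (fderiv ℝ (curl (u t)) x) ≤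
      ∫ x, ⟪u t x, curl (curl (u t)) x⟫ ^ 2 / ‖u t x‖ ^ 2 := fun t ht =>
    not_lt.1 (hsub ⟨hat₁.trans_le ht.1, ht.2⟩)
  exact hsing (hasSmoothExtensionPast_of_eventually_alignedPalinstrophyFraction hν hT hC hη0 hη1 hηC
    ht₁ hsol hLH hdec hA hrate)

end Summit.NavierStokesRegularity.NavierStokesRegularity.Theorems.DepletionLadder

end
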